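import Summits.AtomisticToContinuum.BoseEinsteinCondensation.Theorems.BECGroundStateSOSPeriodicIRBoundDefs
import Summits.AtomisticToContinuum.BoseEinsteinCondensation.Theorems.BECGroundStateSOSPeriodicIRBoundWFDefs
import Summits.AtomisticToContinuum.BoseEinsteinCondensation.Theorems.BECGroundStateSOSPeriodicIRBoundWFPotToolkit
import Literature.MathematicalPhysics.QuantumManyBody.PeriodicBoseGasMomentumSector
import Literature.MathematicalPhysics.QuantumManyBody.TorusFockLayer
import Literature.MathematicalPhysics.QuantumManyBody.TorusFockSectorInteraction
import Literature.MathematicalPhysics.QuantumManyBody.PeriodicFormDomain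
import Literature.MathematicalPhysics.QuantumManyBody.PeriodicBoseGasTagged
import Mathlib.MeasureTheory.Integral.Bochner.ContinuousLinearMap
import HarnessLib

/-! # Crux `PeriodicIRBound` (stmt-AtomisticToContinuum-3972), line `linear-ph-floor-wagner`, stub 5b `stub_wagnerFeynman` — PotCross
The potential cross term, part 1: `∫_{cell^M} W < ∞` for integrable `w`, slice coefficients, the integrands of `Re ∫ W conj(Φ) n̂Φ`. -/

/-!
# of the potential cross term `potRe_w(Φ, n̂Φ)`

for the line `linear-ph-floor-wagner` (crux stmt-AtomisticToContinuum-3972); the assembly is in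
`WFPotCross2.lean`, which depends on this file (dependency order: `WFPotCross` → `WFPotCross2`).

* `lintegral_cellN_periodicInteraction_ne_top`: `∫_{cell^M} ∑_{i<j} w^per(xᵢ - xⱼ) < ∞` for `w(|·|) ∈ L¹(ℝ³)`
  (induction on `M`: Tonelli in the first particle, `W_{m+1}(x::Y) = W_m(Y) + ∑_b w^per(x - y_b)` (TK5) and
  `∫_{cell} w^per(x - c) dx = ‖w‖₁` (TK3));
* the toolkit of the cross term (sub-namespace `PotCross`), with `φ = planeWaveMode L k`, `h = sliceCoef L k Φ`,
  `W = periodicInteraction w L`: continuity of `h` (`continuous_sliceCoef`), integrability of `W.toReal × (continuous)`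
  on the cell, the cross densities `G_j(X) = W(X) conj Φ(X) φ(x_j) h(X̂_j)` (`crossG`, `integrable_crossG`), the key
  identity `∫_x conj Φ(x::Y) φ(x) dx = conj h(Y)` (`integral_conj_mul_planeWaveMode`), the inner `x`-integral of
  `G_0(x::Y)` (`integral_cell_crossG_zero`: `= W(Y)|h(Y)|² + ∑_b I_b(Y)` with the spectator integrals `innerI`),
  and the integrability of `I_b` on the spectator cell (`integrable_innerI`).

-/

noncomputable section

open scoped BigOperators ENNReal ComplexConjugate
open Filter MeasureTheory

namespace Summit.AtomisticToContinuum.BoseEinsteinCondensation.Cruxes.PeriodicIRBound.LinearPhFloorWagner.WF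

open Literature.MathematicalPhysics.QuantumManyBody.BoseGas

variable {M m n : ℕ} {L : ℝ}

/-! ## Measurability and the finiteness of the pair weight on the cell -/

namespace PotCross

/-- Integrating the first particle out of the pair weight:
`∫_{x ∈ cell} W_{m+1}(x::Y) dx = L³ W_m(Y) + m ‖w‖₁` (TK5, TK3). [folklore] -/
private theorem lintegral_cell_periodicInteraction_vecCons (hL : 0 < L) {w : ℝ → ℝ≥0∞} (hw : Measurable w)
    (Y : Config m) :
    ∫⁻ x in cell L, periodicInteraction w L (Matrix.vecCons x Y) =
      periodicInteraction w L Y * ENNReal.ofReal L ^ 3 + (m : ℝ≥0∞) * ∫⁻ z : Space, w ‖z‖ := by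
  have hmeas : ∀ b : Fin m, Measurable fun x : Space => periodizedPotential w L (x - Y b) := fun b =>
    (measurable_periodizedPotential_tk hw L).comp (measurable_id.sub_const _)
  simp only [periodicInteraction_vecCons]
  rw [lintegral_add_left measurable_const, lintegral_const, Measure.restrict_apply_univ, volume_cell,
    lintegral_finsetSum _ fun b _ => hmeas b]
  simp only [lintegral_cell_periodizedPotential_sub hL hw, Finset.sum_const, Finset.card_univ,
    Fintype.card_fin, nsmul_eq_mul]

end PotCross

/-- **The pair weight is integrable on the cell**: `∫_{[0,L)^{3M}} ∑_{i<j} w^per(xᵢ - xⱼ) dX < ∞` when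
`w(|·|) ∈ L¹(ℝ³)` (induction on `M`: `∫_{cell^{m+1}} W_{m+1} = L³ ∫_{cell^m} W_m + m ‖w‖₁ L^{3m}`). -/
theorem lintegral_cellN_periodicInteraction_ne_top (hL : 0 < L) {w : ℝ → ℝ≥0∞} (hw : Measurable w)
    (hint : (∫⁻ z : Space, w ‖z‖) ≠ ⊤) (M : ℕ) :
    ∫⁻ X in cellN M L, periodicInteraction w L X ≠ ⊤ := by
  induction M with
  | zero =>
    have h0 : ∀ X : Config 0, periodicInteraction w L X = 0 := fun X => by
      simp [periodicInteraction]
    simp [h0]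
  | succ m ih =>
    rw [lintegral_cellN_succ L (measurable_periodicInteraction_tk hw L)]
    simp only [PotCross.lintegral_cell_periodicInteraction_vecCons hL hw]
    rw [lintegral_add_right _ measurable_const,
      lintegral_mul_const _ (measurable_periodicInteraction_tk hw L), lintegral_const,
      Measure.restrict_apply_univ, volume_cellN]
    exact ENNReal.add_ne_top.2 ⟨ENNReal.mul_ne_top ih (ENNReal.pow_ne_top ENNReal.ofReal_ne_top),
      ENNReal.mul_ne_top (ENNReal.mul_ne_top (ENNReal.natCast_ne_top m) hint)
        (ENNReal.pow_ne_top (ENNReal.pow_ne_top ENNReal.ofReal_ne_top))⟩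

namespace PotCross

/-! ## The slice coefficient, bounds, integrability -/

/-- The slice coefficient `h = sliceCoef L k Φ` of a continuous `Φ` is continuous (a parametric integral of a
continuous function over the bounded cell, read as an integral over the compact closed box for the measure
restricted to the cell). [folklore] -/
theorem continuous_sliceCoef (L : ℝ) (k : Fin 3 → ℤ) {Φ : Config (m + 1) → ℂ} (hΦ : Continuous Φ) :
    Continuous (sliceCoef L k Φ) := by
  have hK := isCompact_closedBox L
  have hc : Continuous (Function.uncurry fun (Y : Config m) (x : Space) =>
      conj (planeWaveMode L k x) * Φ (Matrix.vecCons x Y)) :=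
    (Complex.continuous_conj.comp ((continuous_planeWaveMode L k).comp continuous_snd)).mul
      (hΦ.comp (continuous_snd.matrixVecCons continuous_fst))
  have h := continuous_parametric_integral_of_continuous
    (μ := (volume : Measure Space).restrict (cell L)) hc hK
  have hμ : ((volume : Measure Space).restrict (cell L)).restrict
      (WithLp.toLp 2 '' Set.univ.pi fun _ : Fin 3 => Set.Icc (0 : ℝ) L : Set Space) =
        (volume : Measure Space).restrict (cell L) := by
    rw [Measure.restrict_restrict hK.isClosed.measurableSet,
      Set.inter_eq_right.2 (cell_subset_closedBox L)]
  rw [hμ] at h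
  exact h

/-- A continuous function on `ℝ³` is bounded on the cell `[0,L)³`. [folklore] -/
private theorem exists_bound_on_cell (L : ℝ) {E : Type*} [SeminormedAddCommGroup E] {f : Space → E}
    (hf : Continuous f) : ∃ C, ∀ x ∈ cell L, ‖f x‖ ≤ C := by
  obtain ⟨C, hC⟩ := (isCompact_closedBox L).exists_bound_of_continuousOn hf.continuousOn
  exact ⟨C, fun x hx => hC x (cell_subset_closedBox L hx)⟩

/-- `X ↦ W(X).toReal` is integrable on the cell (as a complex-valued function). -/
private theorem integrable_toReal_periodicInteraction (hL : 0 < L) {w : ℝ → ℝ≥0∞} (hw : Measurable w)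
    (hint : (∫⁻ z : Space, w ‖z‖) ≠ ⊤) (M : ℕ) :
    Integrable (fun X : Config M => ((periodicInteraction w L X).toReal : ℂ))
      (volume.restrict (cellN M L)) :=
  (integrable_toReal_of_lintegral_ne_top (measurable_periodicInteraction_tk hw L).aemeasurable
    (lintegral_cellN_periodicInteraction_ne_top hL hw hint M)).ofReal

/-- `W.toReal · F` is integrable on the cell for every continuous `F` (bounded on the cell). -/
theorem integrable_toReal_periodicInteraction_mul (hL : 0 < L) {w : ℝ → ℝ≥0∞} (hw : Measurable w)
    (hint : (∫⁻ z : Space, w ‖z‖) ≠ ⊤) {F : Config M → ℂ} (hF : Continuous F) :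
    Integrable (fun X : Config M => ((periodicInteraction w L X).toReal : ℂ) * F X)
      (volume.restrict (cellN M L)) := by
  obtain ⟨C, -, hC⟩ := exists_bound_on_cellN L hF
  exact (integrable_toReal_periodicInteraction hL hw hint M).mul_bdd hF.aestronglyMeasurable
    ((ae_restrict_mem (measurableSet_cellN M L)).mono fun X hX => hC X hX)

/-- `x ↦ w^per(x - c) F(x)` is integrable on the cell for continuous `F` (`w^per(· - c) ∈ L¹(cell)` by TK3,
`F` bounded on the cell). -/
private theorem integrable_periodizedPotential_mul (hL : 0 < L) {w : ℝ → ℝ≥0∞} (hw : Measurable w)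
    (hint : (∫⁻ z : Space, w ‖z‖) ≠ ⊤) (c : Space) {F : Space → ℂ} (hF : Continuous F) :
    Integrable (fun x => ((periodizedPotential w L (x - c)).toReal : ℂ) * F x)
      (volume.restrict (cell L)) := by
  obtain ⟨C, hC⟩ := exists_bound_on_cell L hF
  have hfin : ∫⁻ x in cell L, periodizedPotential w L (x - c) ≠ ⊤ := by
    rw [lintegral_cell_periodizedPotential_sub hL hw]; exact hint
  have hmeas : Measurable fun x : Space => periodizedPotential w L (x - c) :=
    (measurable_periodizedPotential_tk hw L).comp (measurable_id.sub_const c)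
  exact (integrable_toReal_of_lintegral_ne_top hmeas.aemeasurable hfin).ofReal.mul_bdd
    hF.aestronglyMeasurable ((ae_restrict_mem (measurableSet_cell L)).mono fun x hx => hC x hx)

/-! ## The cross densities `G_j` -/

/-- The `j`-th cross density `G_j(X) = W(X) conj Φ(X) φ(x_j) h(X̂_j)` (so that `W conj(Φ) n̂Φ = ∑_j G_j`). -/
def crossG (w : ℝ → ℝ≥0∞) (L : ℝ) (k : Fin 3 → ℤ) (Φ : Config (m + 1) → ℂ) (j : Fin (m + 1))
    (X : Config (m + 1)) : ℂ :=
  ((periodicInteraction w L X).toReal : ℂ) *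
    (conj (Φ X) * (planeWaveMode L k (X j) * sliceCoef L k Φ (j.removeNth X)))

/-- The continuous factor of `G_j` is continuous. -/
theorem continuous_crossFactor (L : ℝ) (k : Fin 3 → ℤ) {Φ : Config (m + 1) → ℂ} (hΦ : Continuous Φ)
    (j : Fin (m + 1)) :
    Continuous fun X : Config (m + 1) =>
      conj (Φ X) * (planeWaveMode L k (X j) * sliceCoef L k Φ (j.removeNth X)) :=
  (Complex.continuous_conj.comp hΦ).mul (((continuous_planeWaveMode L k).comp (continuous_apply j)).mul
    ((continuous_sliceCoef L k hΦ).comp (continuous_removeNth j)))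

/-- `G_j` is integrable on the cell. -/
theorem integrable_crossG (hL : 0 < L) {w : ℝ → ℝ≥0∞} (hw : Measurable w)
    (hint : (∫⁻ z : Space, w ‖z‖) ≠ ⊤) (k : Fin 3 → ℤ) {Φ : Config (m + 1) → ℂ} (hΦ : Continuous Φ)
    (j : Fin (m + 1)) :
    Integrable (crossG w L k Φ j) (volume.restrict (cellN (m + 1) L)) :=
  integrable_toReal_periodicInteraction_mul hL hw hint (continuous_crossFactor L k hΦ j)

/-! ## The term `j = 0`: Fubini in the first particle and the splitting of the weight -/

/-- KEY: `∫_x conj Φ(x::Y) φ(x) dx = conj h(Y)`. -/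
theorem integral_conj_mul_planeWaveMode (L : ℝ) (k : Fin 3 → ℤ) (Φ : Config (m + 1) → ℂ) (Y : Config m) :
    ∫ x in cell L, conj (Φ (Matrix.vecCons x Y)) * planeWaveMode L k x = conj (sliceCoef L k Φ Y) := by
  rw [sliceCoef, ← integral_conj]
  refine integral_congr_ae (Eventually.of_forall fun x => ?_)
  dsimp only
  rw [map_mul, Complex.conj_conj, mul_comm]

/-- The spectator inner integral `I_b(Y) = ∫_x w^per(x - y_b) conj Φ(x::Y) φ(x) h(Y) dx`
(so that `s_b = mixCoef w L k Φ b = ∫_Y I_b(Y)`). -/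
def innerI (w : ℝ → ℝ≥0∞) (L : ℝ) (k : Fin 3 → ℤ) (Φ : Config (m + 1) → ℂ) (b : Fin m)
    (Y : Config m) : ℂ :=
  ∫ x in cell L, ((periodizedPotential w L (x - Y b)).toReal : ℂ) *
    (conj (Φ (Matrix.vecCons x Y)) * planeWaveMode L k x * sliceCoef L k Φ Y)

/-- (3)–(4) The inner `x`-integral at a spectator configuration `Y` with `W(Y) < ∞`:
`∫_x G_0(x::Y) dx = W(Y) conj h(Y) h(Y) + ∑_b I_b(Y)` (TK5 splits the weight; all its terms are finite for
a.e. `x`; then the KEY identity). -/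
theorem integral_cell_crossG_zero (hL : 0 < L) {w : ℝ → ℝ≥0∞} (hw : Measurable w)
    (hint : (∫⁻ z : Space, w ‖z‖) ≠ ⊤) (k : Fin 3 → ℤ) {Φ : Config (m + 1) → ℂ} (hΦ : Continuous Φ)
    {Y : Config m} (hY : periodicInteraction w L Y ≠ ⊤) :
    ∫ x in cell L, crossG w L k Φ 0 (Matrix.vecCons x Y) =
      ((periodicInteraction w L Y).toReal : ℂ) * (conj (sliceCoef L k Φ Y) * sliceCoef L k Φ Y) +
        ∑ b : Fin m, innerI w L k Φ b Y := by
  -- for a.e. `x` in the cell all the weights `w^per(x - y_b)` are finite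
  have hae : ∀ᵐ x ∂(volume.restrict (cell L)), ∀ b : Fin m, periodizedPotential w L (x - Y b) < ⊤ := by
    rw [ae_all_iff]
    intro b
    refine ae_lt_top ((measurable_periodizedPotential_tk hw L).comp (measurable_id.sub_const _)) ?_
    rw [lintegral_cell_periodizedPotential_sub hL hw]
    exact hint
  -- the pointwise identity
  have hpt : ∀ᵐ x ∂(volume.restrict (cell L)), crossG w L k Φ 0 (Matrix.vecCons x Y) =
      ((periodicInteraction w L Y).toReal : ℂ) *
          (conj (Φ (Matrix.vecCons x Y)) * planeWaveMode L k x * sliceCoef L k Φ Y) +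
        ∑ b : Fin m, ((periodizedPotential w L (x - Y b)).toReal : ℂ) *
          (conj (Φ (Matrix.vecCons x Y)) * planeWaveMode L k x * sliceCoef L k Φ Y) := by
    filter_upwards [hae] with x hx
    unfold crossG
    rw [Matrix.cons_val_zero, removeNth_zero_vecCons, periodicInteraction_vecCons,
      ENNReal.toReal_add hY (ENNReal.sum_ne_top.2 fun b _ => (hx b).ne),
      ENNReal.toReal_sum fun b _ => (hx b).ne]
    push_cast
    rw [add_mul, Finset.sum_mul]
    simp only [mul_assoc]
  -- integrability of the pieces in `x`
  have hc : Continuous fun x : Space =>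
      conj (Φ (Matrix.vecCons x Y)) * planeWaveMode L k x * sliceCoef L k Φ Y :=
    ((Complex.continuous_conj.comp (hΦ.comp (continuous_id.matrixVecCons continuous_const))).mul
      (continuous_planeWaveMode L k)).mul continuous_const
  have h1 : Integrable (fun x : Space => ((periodicInteraction w L Y).toReal : ℂ) *
      (conj (Φ (Matrix.vecCons x Y)) * planeWaveMode L k x * sliceCoef L k Φ Y))
      (volume.restrict (cell L)) :=
    (integrableOn_cell hc).const_mul _
  have h2 : ∀ b : Fin m, Integrable (fun x : Space => ((periodizedPotential w L (x - Y b)).toReal : ℂ) *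
      (conj (Φ (Matrix.vecCons x Y)) * planeWaveMode L k x * sliceCoef L k Φ Y))
      (volume.restrict (cell L)) :=
    fun b => integrable_periodizedPotential_mul hL hw hint (Y b) hc
  rw [integral_congr_ae hpt, integral_add h1 (integrable_finsetSum _ fun b _ => h2 b),
    integral_finsetSum _ (fun b _ => h2 b), integral_const_mul, integral_mul_const,
    integral_conj_mul_planeWaveMode]
  rfl

/-! ## The outer integral over the spectators -/

/-- `I_b` is strongly measurable in the spectators (the integrand is jointly measurable). -/
theorem stronglyMeasurable_innerI {w : ℝ → ℝ≥0∞} (hw : Measurable w) (L : ℝ) (k : Fin 3 → ℤ)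
    {Φ : Config (m + 1) → ℂ} (hΦ : Continuous Φ) (b : Fin m) :
    StronglyMeasurable (innerI w L k Φ b) := by
  have hmeas : Measurable fun p : Config m × Space =>
      ((periodizedPotential w L (p.2 - p.1 b)).toReal : ℂ) *
        (conj (Φ (Matrix.vecCons p.2 p.1)) * planeWaveMode L k p.2 * sliceCoef L k Φ p.1) := by
    refine (Complex.measurable_ofReal.comp ((measurable_periodizedPotential_tk hw L).comp
      (measurable_snd.sub ((measurable_pi_apply b).comp measurable_fst))).ennreal_toReal).mul ?_
    exact (((Complex.continuous_conj.comp (hΦ.comp (continuous_snd.matrixVecCons continuous_fst))).mul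
      ((continuous_planeWaveMode L k).comp continuous_snd)).mul
        ((continuous_sliceCoef L k hΦ).comp continuous_fst)).measurable
  exact hmeas.stronglyMeasurable.integral_prod_right' (ν := (volume : Measure Space).restrict (cell L))

/-- `I_b` is bounded on the spectator cell: `‖I_b(Y)‖ ≤ ‖w‖₁ · C_Φ L^{-3/2} C_h` for `Y ∈ cell^m`. -/
theorem norm_innerI_le (hL : 0 < L) {w : ℝ → ℝ≥0∞} (hw : Measurable w)
    (hint : (∫⁻ z : Space, w ‖z‖) ≠ ⊤) (k : Fin 3 → ℤ) (Φ : Config (m + 1) → ℂ)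
    (b : Fin m) {CΦ Ch : ℝ} (hCΦ0 : 0 ≤ CΦ) (hCΦ : ∀ X ∈ cellN (m + 1) L, ‖Φ X‖ ≤ CΦ)
    (hCh : ∀ Y ∈ cellN m L, ‖sliceCoef L k Φ Y‖ ≤ Ch) {Y : Config m} (hY : Y ∈ cellN m L) :
    ‖innerI w L k Φ b Y‖ ≤ (∫⁻ z : Space, w ‖z‖).toReal * (CΦ * (Real.sqrt (L ^ 3))⁻¹ * Ch) := by
  have hmeas : Measurable fun x : Space => periodizedPotential w L (x - Y b) :=
    (measurable_periodizedPotential_tk hw L).comp (measurable_id.sub_const _)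
  have hfin : ∫⁻ x in cell L, periodizedPotential w L (x - Y b) ≠ ⊤ := by
    rw [lintegral_cell_periodizedPotential_sub hL hw]; exact hint
  have hg : Integrable (fun x : Space => (periodizedPotential w L (x - Y b)).toReal *
      (CΦ * (Real.sqrt (L ^ 3))⁻¹ * Ch)) (volume.restrict (cell L)) :=
    (integrable_toReal_of_lintegral_ne_top hmeas.aemeasurable hfin).mul_const _
  have hs : 0 ≤ (Real.sqrt (L ^ 3))⁻¹ := inv_nonneg.2 (Real.sqrt_nonneg _)
  refine (norm_integral_le_of_norm_le hg ?_).trans_eq ?_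
  · filter_upwards [ae_restrict_mem (measurableSet_cell L)] with x hx
    have hmem : Matrix.vecCons x Y ∈ cellN (m + 1) L := vecCons_mem_cellN_succ_iff.2 ⟨hx, hY⟩
    rw [norm_mul, Complex.norm_real, Real.norm_of_nonneg ENNReal.toReal_nonneg, norm_mul, norm_mul,
      Complex.norm_conj, norm_planeWaveMode]
    refine mul_le_mul_of_nonneg_left ?_ ENNReal.toReal_nonneg
    exact mul_le_mul (mul_le_mul_of_nonneg_right (hCΦ _ hmem) hs) (hCh Y hY) (norm_nonneg _)
      (mul_nonneg hCΦ0 hs)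
  · rw [integral_mul_const, integral_toReal hmeas.aemeasurable (ae_lt_top hmeas hfin),
      lintegral_cell_periodizedPotential_sub hL hw]

/-- `I_b` is integrable on the spectator cell (bounded and measurable on a set of finite measure). -/
theorem integrable_innerI (hL : 0 < L) {w : ℝ → ℝ≥0∞} (hw : Measurable w)
    (hint : (∫⁻ z : Space, w ‖z‖) ≠ ⊤) (k : Fin 3 → ℤ) {Φ : Config (m + 1) → ℂ} (hΦ : Continuous Φ)
    (b : Fin m) : Integrable (innerI w L k Φ b) (volume.restrict (cellN m L)) := by
  obtain ⟨CΦ, hCΦ0, hCΦ⟩ := exists_bound_on_cellN L hΦ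
  obtain ⟨Ch, -, hCh⟩ := exists_bound_on_cellN L (continuous_sliceCoef L k hΦ)
  have hvol : volume (cellN m L) ≠ ⊤ := by
    rw [volume_cellN]; exact ENNReal.pow_ne_top (ENNReal.pow_ne_top ENNReal.ofReal_ne_top)
  exact Measure.integrableOn_of_bounded hvol
    (stronglyMeasurable_innerI hw L k hΦ b).aestronglyMeasurable
    ((ae_restrict_mem (measurableSet_cellN m L)).mono fun Y hY =>
      norm_innerI_le hL hw hint k Φ b hCΦ0 hCΦ hCh hY)

end PotCross

end Summit.AtomisticToContinuum.BoseEinsteinCondensation.Cruxes.PeriodicIRBound.LinearPhFloorWagner.WF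

end

namespace Summit.AtomisticToContinuum.BoseEinsteinCondensation.Cruxes.PeriodicIRBound.LinearPhFloorWagner

/-- The registered sub-goal `stub_wfPotCross` of the crux ledger: this file's headline lemma `WF.lintegral_cellN_periodicInteraction_ne_top`. -/
theorem stub_wfPotCross : WF.Pkg.PotCross :=
  @WF.lintegral_cellN_periodicInteraction_ne_top

end Summit.AtomisticToContinuum.BoseEinsteinCondensation.Cruxes.PeriodicIRBound.LinearPhFloorWagner
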